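import Mathlib
import Literature.NumberTheory.LFunctions.Zhang2022.Section2Lemma23Holds
import Literature.NumberTheory.LFunctions.Zhang2022.TypedSection01and02C
import Literature.NumberTheory.LFunctions.Zhang2022.SkeletonPartOneC
import HarnessLib

/-!
# Zhang (2022) §2, proof of Lemma 2.3 (pp. 11–12), III: the typed steps `§2.u035a`, `§2.u035`,
# `§2.u036`, `§2.u037`, `§2.u038` and the Remark (2.34) from Proposition 2.2, kernel-checked

Topic `Literature/NumberTheory/LFunctions/Zhang2022` (Landau–Siegel adjudication tree;
verdict-neutral). Y. Zhang, *Discrete mean estimates and the Landau–Siegel zero*,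
arXiv:2211.02515v1 (2022) [Zhang2022LandauSiegel] — an unrefereed manuscript under adjudication.
The row `TypedSection01and02C` (L1-t3) types the five displayed steps of the proof of Lemma 2.3
[Z22 pp. 11–12, tex L667–L685] and the Remark (2.34) [tex L687] as the CLAIM nodes
`Section2.Step2u035a/035/036/037/038 c′`, `Section2.Eq234 c′` — each under the standing quantifier,
for `ψ ∈ Ψ₁`, `ρ ∈ 𝔷(ψ)`, WITHOUT Proposition 2.2 as an antecedent (the manuscript treats
Proposition 2.2 as proved at that point). This file PROVES each of them FROM `Skeleton.Prop22 c′`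
(`c′ ≥ 0`), i.e. the edges "Proposition 2.2 ⇒ step", from the pointwise theorems of
`Section2Lemma23Holds.lean` / `Section2Lemma23Inputs.lean`:

* `step2u035a_of_prop22` — "`M(ρ+iv,ψ) ≠ 0` if `|β₂| ≤ v ≤ |β₃|`";
* `step2u035_of_prop22` — "`M(ρ+β₂,ψ)M(ρ+β₃,ψ) > 0`";
* `step2u036_of_prop22` — "`M(ρ+β₁,ψ)/M(ρ+iv,ψ) > 0` if `0 < v ≤ |β₁|`";
* `step2u037_of_prop22` — "`M(ρ+β₁,ψ)/(iM′(ρ,ψ)) = lim_{v→0⁺} vM(ρ+β₁,ψ)/M(ρ+iv,ψ)`";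
* `step2u038_of_prop22` — "`M(ρ+β₁,ψ)/(iM′(ρ,ψ)) ≥ 0`";
* `eq234_of_prop22` — (2.34) "`|L(ρ+β₁,ψ)/L′(ρ,ψ)| = −iM(ρ+β₁,ψ)/M′(ρ,ψ)`".

(With `Section2.lemma23_of_steps` this re-derives `Skeleton.ded23_holds`.) No new definitions, no
named facts; nothing here bears on Theorems 1–2 of the source or on the cell's verdict on (8.24).
Cell siegel-zhang (D-0069), discharge row D20 / cone C11, nodes `Z22:§2.u035`–`§2.u038`, `Z22:(2.34)`.

## References

* Y. Zhang, arXiv:2211.02515v1 (2022), §2, proof of Lemma 2.3 pp. 11–12 and Remark (2.34) p. 12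
  (tex L667–L690). [cite: Zhang2022LandauSiegel, §2 Lemma 2.3 (proof), (2.34) pp. 11–12]
-/

noncomputable section

open Complex Real Filter Topology Set

namespace Literature.NumberTheory.LFunctions.Zhang2022.Section2

open Literature.NumberTheory.LFunctions.Zhang2022 Skeleton

variable {D : ℕ}

/-- `|β₁| = α(1 − 5c′α𝓛)` when `5c′α𝓛 < 1` (2.13). [cite: Zhang2022LandauSiegel, §2 (2.13)] -/
theorem norm_beta1 {c' : ℝ} (hα : 0 < alpha D) (hsmall : 5 * c' * alpha D * ell D < 1) :
    ‖beta1 c' D‖ = alpha D * (1 - 5 * c' * alpha D * ell D) := by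
  have h : beta1 c' D = ((alpha D * (1 - 5 * c' * alpha D * ell D) : ℝ) : ℂ) * I := by
    rw [beta1]; push_cast; ring
  rw [h, norm_mul, Complex.norm_I, mul_one, Complex.norm_real,
    Real.norm_of_nonneg (mul_nonneg hα.le (by linarith))]

/-- `|β₂| = 2α(1 + c′α𝓛)` for `c′ ≥ 0` (2.13). [cite: Zhang2022LandauSiegel, §2 (2.13)] -/
theorem norm_beta2 {c' : ℝ} (hc' : 0 ≤ c') (hα : 0 < alpha D) (hℓ : 0 < ell D) :
    ‖beta2 c' D‖ = 2 * alpha D * (1 + c' * alpha D * ell D) := by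
  have h : beta2 c' D = ((2 * alpha D * (1 + c' * alpha D * ell D) : ℝ) : ℂ) * I := by
    rw [beta2]; push_cast; ring
  rw [h, norm_mul, Complex.norm_I, mul_one, Complex.norm_real, Real.norm_of_nonneg (by positivity)]

/-- `|β₃| = 3α(1 − c′α𝓛)` when `c′α𝓛 ≤ 1` (2.13). [cite: Zhang2022LandauSiegel, §2 (2.13)] -/
theorem norm_beta3 {c' : ℝ} (hα : 0 < alpha D) (hsmall : c' * alpha D * ell D ≤ 1) :
    ‖beta3 c' D‖ = 3 * alpha D * (1 - c' * alpha D * ell D) := by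
  have h : beta3 c' D = ((3 * alpha D * (1 - c' * alpha D * ell D) : ℝ) : ℂ) * I := by
    rw [beta3]; push_cast; ring
  rw [h, norm_mul, Complex.norm_I, mul_one, Complex.norm_real,
    Real.norm_of_nonneg (mul_nonneg (by positivity) (by linarith))]

/-- For `ρ` on the critical line, `ρ + iv = ½ + i(γ + v)`. [folklore] -/
private theorem add_mul_I_eq {ρ : ℂ} (hre : ρ.re = 1 / 2) (v : ℝ) :
    ρ + v * I = (1 : ℂ) / 2 + ((ρ.im + v : ℝ) : ℂ) * I :=
  Complex.ext (by simp [hre]) (by simp)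

/-- **`Z22:§2.u035a` from Proposition 2.2**: "By (2.) [Prop. 2.2 (iii) restated] we see that
`M(ρ+iv,ψ) ≠ 0` if `|β₂| ≤ v ≤ |β₃|`" (p. 11), for `ψ ∈ Ψ₁`, `ρ ∈ 𝔷(ψ)`, all large `D`.
[cite: Zhang2022LandauSiegel, §2 proof of Lemma 2.3 p. 11] -/
theorem step2u035a_of_prop22 {c' : ℝ} (hc' : 0 ≤ c') (h22 : Skeleton.Prop22 c') :
    Step2u035a c' := by
  rw [Step2u035a]
  refine forAllLarge_of_prop22 h22 fun D _ χ hD hp hsmall hαhalf h x hx ρ hρ v hv2 hv3 => ?_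
  have hℓ : 1 < ell D := one_lt_ell hD
  have hα : 0 < alpha D := alpha_pos hD
  have hre : ρ.re = 1 / 2 := (h x hx).1 ρ (mem_prodZeroSetOmega_of_mem_zeroSet χ hρ)
  have h1 : c' * alpha D * ell D ≤ 1 := by
    have : 0 ≤ c' * alpha D * ell D := by positivity
    linarith
  rw [norm_beta2 hc' hα (by linarith)] at hv2
  rw [norm_beta3 hα h1] at hv3
  rw [add_mul_I_eq hre]
  exact Mfun_half_ne_zero_of_prop22_at χ hD hp hc' hsmall hαhalf x (h x hx).2.2 hρ
    (Or.inr ⟨by linarith, by linarith⟩)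

/-- **`Z22:§2.u035` from Proposition 2.2**: "This implies, by the mean-value theorem, that
`M(ρ+β₂,ψ)M(ρ+β₃,ψ) > 0`" (p. 11) — a positive real — for `ψ ∈ Ψ₁`, `ρ ∈ 𝔷(ψ)`, all large `D`.
[cite: Zhang2022LandauSiegel, §2 proof of Lemma 2.3 p. 11] -/
theorem step2u035_of_prop22 {c' : ℝ} (hc' : 0 ≤ c') (h22 : Skeleton.Prop22 c') :
    Step2u035 c' := by
  rw [Step2u035]
  exact forAllLarge_of_prop22 h22 fun _ _ χ hD hp hsmall hαhalf h x hx _ hρ =>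
    (M_signs_of_prop22_at χ hD hp hc' hsmall hαhalf x (h x hx).1 (h x hx).2.1 (h x hx).2.2 hρ).2

/-- **`Z22:§2.u036` from Proposition 2.2**: "Similarly we have `M(ρ+β₁,ψ)/M(ρ+iv,ψ) > 0` if
`0 < v ≤ |β₁|`" (pp. 11–12) — the real continuous `u ↦ M(½+iu,ψ)` has no zero on
`(γ, γ+|β₁|]`, so it has one sign there — for `ψ ∈ Ψ₁`, `ρ ∈ 𝔷(ψ)`, all large `D`.
[cite: Zhang2022LandauSiegel, §2 proof of Lemma 2.3 pp. 11–12] -/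
theorem step2u036_of_prop22 {c' : ℝ} (hc' : 0 ≤ c') (h22 : Skeleton.Prop22 c') :
    Step2u036 c' := by
  rw [Step2u036]
  refine forAllLarge_of_prop22 h22 fun D _ χ hD hp hsmall hαhalf h x hx ρ hρ v hv0 hv1 => ?_
  have hα : 0 < alpha D := alpha_pos hD
  have hγ : 0 < ρ.im := im_pos_of_mem_zeroSet hD hρ
  have hre : ρ.re = 1 / 2 := (h x hx).1 ρ (mem_prodZeroSetOmega_of_mem_zeroSet χ hρ)
  rw [norm_beta1 hα hsmall] at hv1
  set v₁ : ℝ := alpha D * (1 - 5 * c' * alpha D * ell D) with hv₁_def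
  -- the real function `m(u) = M(½+iu,ψ)` on `[γ+v, γ+v₁]`
  set m : ℝ → ℝ := fun u => (Mfun x.ψ ((1 : ℂ) / 2 + u * I)).re with hm_def
  have hmne : ∀ u ∈ Icc (ρ.im + v) (ρ.im + v₁), m u ≠ 0 := by
    intro u hu hmu
    have hupos : 0 < u := by linarith [hu.1]
    apply Mfun_half_ne_zero_of_prop22_at χ hD hp hc' hsmall hαhalf x (h x hx).2.2 hρ
      (Or.inl ⟨by linarith [hu.1], hu.2⟩)
    rw [Mfun_half_eq_ofReal x hupos]
    simp only [hm_def] at hmu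
    rw [hmu, Complex.ofReal_zero]
  have hsign : 0 < m (ρ.im + v) * m (ρ.im + v₁) :=
    mul_pos_of_continuousOn_of_ne_zero (by linarith) (continuousOn_Mfun_half_re x (by linarith)) hmne
  have hM₁ : Mfun x.ψ (ρ + beta1 c' D) = ((m (ρ.im + v₁) : ℝ) : ℂ) := by
    rw [add_beta1_eq hre]; exact Mfun_half_eq_ofReal x (by linarith)
  have hMv : Mfun x.ψ (ρ + v * I) = ((m (ρ.im + v) : ℝ) : ℂ) := by
    rw [add_mul_I_eq hre]; exact Mfun_half_eq_ofReal x (by linarith)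
  have hmv0 : m (ρ.im + v) ≠ 0 := hmne _ (left_mem_Icc.mpr (by linarith))
  have hq : Mfun x.ψ (ρ + beta1 c' D) / Mfun x.ψ (ρ + v * I)
      = ((m (ρ.im + v₁) / m (ρ.im + v) : ℝ) : ℂ) := by
    rw [hM₁, hMv]; push_cast; ring
  have hpos : 0 < m (ρ.im + v₁) / m (ρ.im + v) := by
    have : m (ρ.im + v₁) / m (ρ.im + v)
        = m (ρ.im + v) * m (ρ.im + v₁) / (m (ρ.im + v) * m (ρ.im + v)) := by
      field_simp
    rw [this]
    exact div_pos hsign (mul_self_pos.mpr hmv0)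
  rw [hq, Complex.ofReal_im, Complex.ofReal_re]
  exact ⟨rfl, hpos⟩

/-- **`Z22:§2.u037` from Proposition 2.2**: "Since
`M(ρ+β₁,ψ)/(iM′(ρ,ψ)) = lim_{v→0⁺} vM(ρ+β₁,ψ)/M(ρ+iv,ψ)`" (p. 12): `M(ρ+iv) = ivM′(ρ) + o(v)`
with `M′(ρ) ≠ 0` (simplicity, Prop. 2.2 (ii)), for `ψ ∈ Ψ₁`, `ρ ∈ 𝔷(ψ)`, all large `D`.
[cite: Zhang2022LandauSiegel, §2 proof of Lemma 2.3 p. 12] -/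
theorem step2u037_of_prop22 {c' : ℝ} (h22 : Skeleton.Prop22 c') : Step2u037 c' := by
  rw [Step2u037]
  refine forAllLarge_of_prop22 h22 fun D _ χ hD hp _ _ h x hx ρ hρ => ?_
  have hγ : 0 < ρ.im := im_pos_of_mem_zeroSet hD hρ
  have hρS := mem_prodZeroSetOmega_of_mem_zeroSet χ hρ
  have hL0 : x.ψ.LFunction ρ = 0 := hρ.2.2
  -- `M′(ρ) ≠ 0`
  have hd0 : deriv (Mfun x.ψ) ρ ≠ 0 := by
    have hL1 := deriv_LFunction_ne_zero_of_deriv_LL_ne_zero χ hD hp x hL0 ((h x hx).2.1 ρ hρS)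
    exact GammaFactor.deriv_M_ne_zero_of_simple_zero x.prim x.p_ne_one (Yroot_spec x.prim).1
      (Yroot_spec x.prim).2 hγ hL0 hL1
  -- `g(v) = M(ρ + iv)` has `g(0) = 0`, `g′(0) = iM′(ρ)`
  set g : ℝ → ℂ := fun v => Mfun x.ψ (ρ + v * I) with hg_def
  have hUo : IsOpen {s : ℂ | 0 < s.im} := isOpen_lt continuous_const Complex.continuous_im
  have hMd : DifferentiableAt ℂ (Mfun x.ψ) ρ :=
    (differentiableOn_Mfun x).differentiableAt (hUo.mem_nhds hγ)
  have haff : HasDerivAt (fun v : ℝ => ρ + v * I) I 0 := by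
    simpa using ((hasDerivAt_id (0 : ℝ)).ofReal_comp.mul_const I).const_add ρ
  have hg : HasDerivAt g (deriv (Mfun x.ψ) ρ * I) 0 := by
    have h0 : ρ + ((0 : ℝ) : ℂ) * I = ρ := by simp
    have h1 : HasDerivAt (Mfun x.ψ) (deriv (Mfun x.ψ) ρ) (ρ + ((0 : ℝ) : ℂ) * I) := by
      rw [h0]; exact hMd.hasDerivAt
    exact h1.comp (0 : ℝ) haff
  have hg0 : g 0 = 0 := by
    simp only [hg_def, Complex.ofReal_zero, zero_mul, add_zero]
    rw [show Mfun x.ψ ρ = Yroot x.ψ ρ * x.ψ.LFunction ρ from rfl, hL0, mul_zero]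
  have hslope : Tendsto (fun v : ℝ => v⁻¹ • (g (0 + v) - g 0)) (𝓝[>] 0)
      (𝓝 (deriv (Mfun x.ψ) ρ * I)) := hg.tendsto_slope_zero_right
  have hlim : Tendsto (fun v : ℝ => Mfun x.ψ (ρ + beta1 c' D) / (v⁻¹ • (g (0 + v) - g 0)))
      (𝓝[>] 0) (𝓝 (Mfun x.ψ (ρ + beta1 c' D) / (deriv (Mfun x.ψ) ρ * I))) :=
    tendsto_const_nhds.div hslope (mul_ne_zero hd0 I_ne_zero)
  rw [mul_comm (deriv (Mfun x.ψ) ρ) I] at hlim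
  refine hlim.congr' ?_
  filter_upwards [self_mem_nhdsWithin] with v (_ : 0 < v)
  rw [hg0, sub_zero, zero_add]
  simp only [hg_def, Complex.real_smul, Complex.ofReal_inv]
  rw [inv_mul_eq_div, div_div_eq_mul_div, mul_comm (Mfun x.ψ (ρ + beta1 c' D)) (v : ℂ)]

/-- **`Z22:§2.u038` from Proposition 2.2**: "it follows that `M(ρ+β₁,ψ)/(iM′(ρ,ψ)) ≥ 0`" (p. 12)
(indeed `> 0`, `M_signs_of_prop22_at`), for `ψ ∈ Ψ₁`, `ρ ∈ 𝔷(ψ)`, all large `D`.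
[cite: Zhang2022LandauSiegel, §2 proof of Lemma 2.3 p. 12] -/
theorem step2u038_of_prop22 {c' : ℝ} (hc' : 0 ≤ c') (h22 : Skeleton.Prop22 c') :
    Step2u038 c' := by
  rw [Step2u038]
  exact forAllLarge_of_prop22 h22 fun _ _ χ hD hp hsmall hαhalf h x hx _ hρ =>
    let hq := (M_signs_of_prop22_at χ hD hp hc' hsmall hαhalf x (h x hx).1 (h x hx).2.1
      (h x hx).2.2 hρ).1
    ⟨hq.1, hq.2.le⟩

/-- **`Z22:(2.34)` from Proposition 2.2** (Remark, p. 12): "It is implied in the proof of Lemma 2.3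
that `|L(ρ+β₁,ψ)/L′(ρ,ψ)| = −iM(ρ+β₁,ψ)/M′(ρ,ψ)` for `ψ ∈ Ψ₁` and `ρ ∈ 𝔷(ψ)`", all large `D`.
[cite: Zhang2022LandauSiegel, §2 (2.34) p. 12] -/
theorem eq234_of_prop22 {c' : ℝ} (hc' : 0 ≤ c') (h22 : Skeleton.Prop22 c') : Eq234 c' := by
  rw [Eq234]
  exact forAllLarge_of_prop22 h22 fun _ _ χ hD hp hsmall hαhalf h x hx _ hρ =>
    eq234_of_prop22_at χ hD hp hc' hsmall hαhalf x (h x hx).1 (h x hx).2.1 (h x hx).2.2 hρ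

/-- **The manuscript's route to Lemma 2.3, end to end**: Proposition 2.2 ⇒ steps `§2.u035`,
`§2.u038` ⇒ Lemma 2.3 (`lemma23_of_steps`), agreeing with `Skeleton.ded23_holds`.
[cite: Zhang2022LandauSiegel, §2 proof of Lemma 2.3 pp. 11–12] -/
theorem lemma23_of_prop22 {c' : ℝ} (hc' : 0 ≤ c') (h22 : Skeleton.Prop22 c') :
    Skeleton.Lemma23 c' :=
  lemma23_of_steps (step2u035_of_prop22 hc' h22) (step2u038_of_prop22 hc' h22)

end Literature.NumberTheory.LFunctions.Zhang2022.Section2
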